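import Literature.NumberTheory.Automorphic.IdeleNormGalConj
import Literature.NumberTheory.Automorphic.NormGroupClosedProofs
import Literature.NumberTheory.Automorphic.IdeleClassGroupProofs
import Mathlib.MeasureTheory.Measure.Haar.Basic
import Mathlib.NumberTheory.NumberField.CMField
import HarnessLib

/-!
# The relative norm-one idele torus `U(1)_{L/K}(𝔸_K)` and its compact automorphic quotient

Topic `NumberTheory/Automorphic`; namespace `Literature.NumberTheory.Automorphic`. For an extension of
number fields `K → L` (the application is `K = L⁺`, the maximal real subfield of a CM field `L`, file
`RelNormOneTorusHaar`), write `N : 𝔸_Lˣ → 𝔸_Lˣ`, `N y = ∏_{σ ∈ Aut(L/K)} σ • y` for the Galois norm on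
ideles (the tree's `AdeleRing.ideleGalNorm K L`, `ClassFieldCharacter`). For a hermitian LINE `W` over a
CM extension `L/L⁺` the unitary group is the anisotropic torus
`U(W) = U(1)_{L/L⁺} = ker (N_{L/L⁺} : Res_{L/L⁺} 𝔾_m → 𝔾_m)`, so `U(W)(𝔸_{L⁺}) = {y ∈ 𝔸_Lˣ : y ȳ = 1}`
and `U(W)(L⁺) = L¹ = {ℓ ∈ Lˣ : ℓ ℓ̄ = 1}`; theta lifts from `U(1)` are integrals over the compact
quotient `[U(1)] = L¹ \ U(1)(𝔸)`, and the CM points of a Picard modular surface at a level `U_f` are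
indexed by the finite set `L¹ \ U(1)(𝔸) / U(1)_∞ U_f`. This file CONSTRUCTS these objects over the
tree's idele library (`IdeleClassGroup`: `GaloisRepresentations.ideleGroup L = 𝔸_Lˣ`,
`IdeleClassGroup.ideleNorm`, `normOneIdeles`, `GaloisRepresentations.principalIdeles`) and PROVES:

* `ideleNorm_galSmul` — Galois invariance of the idele norm `‖σ • x‖ = ‖x‖` (the tree's
  `ideleNorm_unitsMap_galRingHom`, `IdeleNormGalConj`, moved to `IdeleClassGroup.ideleNorm`), whence
  `‖N y‖ = ‖y‖ ^ #Aut(L/K)` (`ideleNorm_ideleGalNorm`);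
* `relNormOneIdeles K L = ker N ≤ 𝔸_Lˣ`, a closed subgroup contained in the norm-one ideles `𝕀_L¹`
  (`relNormOneIdeles_le_normOneIdeles`), locally compact;
* `relNormOneRat K L = ker N ∩ Lˣ`, the rational points; for `L/K` Galois a principal idele `(ℓ)` lies in
  the torus iff `N_{L/K} ℓ = 1` (`principal_mem_relNormOneIdeles_iff`); **discrete**
  (`discreteTopology_relNormOneRat`, from the tree's `discreteTopology_principalIdeles`) and closed;
* **`CompactSpace (relNormOneIdeles K L ⧸ relNormOneRat K L)`** (`compactSpace_relNormOneQuot`): from the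
  compactness of `𝕀_L¹ / Lˣ` in the cover form of the tree's `exists_finset_normBox_of_ideleNorm_eq_one`
  (`NormOneIdeleClassCompact`: a compact `W ⊆ 𝔸_Lˣ` meeting every coset `a Lˣ`, `a ∈ 𝕀_L¹`) by a
  FINITE-REPRESENTATIVES argument: `F := N(W) ∩ Lˣ` is finite (compact ∩ discrete closed); choosing for
  each `m ∈ F ∩ N(Lˣ)` one `k_m ∈ Lˣ` with `N k_m = m` gives `ker N = (ker N ∩ ⋃_{m ∈ F} W k_m⁻¹) · L¹`, so
  `[U(1)]` is the continuous image of a compact set. No Hasse norm theorem, no Hilbert 90 and no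
  reduction theory is used; this is Godement's compactness criterion (Sém. Bourbaki 257, Thm. 4:
  `G_A/G_k` compact for anisotropic reductive `G`) in the special case of the torus `U(1)_{L/K}`, proved
  directly;
* the Haar probability datum on `[U(1)]`: Borel σ-algebra, `haarRelNormOneQuot K L := Measure.haar`,
  finite, positive on opens, left and right invariant.

The CM specialisation (`N y = y · ȳ`), level finiteness `#(L¹ \ U(1)(𝔸) / U) < ∞` for open `U` and
the archimedean torus are in the sibling files `RelNormOneTorusHaar`, `RelNormOneTorusArch`.

## References

* J. W. S. Cassels, A. Fröhlich (eds.), *Algebraic Number Theory* (1967), Ch. II (Cassels) §16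
  Theorem (`J¹/kˣ` compact), §16 Lemma (`kˣ` discrete in `J`); Ch. VII (Tate) §1.1 (Galois action on
  places and completions). [CasselsFrohlichANT1967]
* R. Godement, *Domaines fondamentaux des groupes arithmétiques*, Sém. Bourbaki 257 (1962/63), §5
  Thm. 4 (`G_A/G_k` compact iff `G` anisotropic; here the torus case). [Godement1964]
* V. Platonov, A. Rapinchuk, *Algebraic Groups and Number Theory* (1994), Thm. 5.5 (compactness
  criterion), §6.2 (tori). [PlatonovRapinchuk1994]

## Provenance

Reproduced for the tree under the LEAN-IN-TREE rule from the pub-hodgecm cell's package file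
`HodgeCM/PerL34/NormOneRelTorus.lean` (427 lines; DAG-node prover #11 lineage, seat pv11-g4, gate run 25),
re-based on the tree's idele library (`HodgeCM`'s `NumberField.ideleGroup / ideleNorm / finIdeleNorm /
principalIdeles / normOneIdeleCompactCover_of_compact` ↦ `GaloisRepresentations.ideleGroup`,
`IdeleClassGroup.ideleNorm`, `GaloisRepresentations.principalIdeles`,
`exists_finset_normBox_of_ideleNorm_eq_one`); §1's finite-place isometry already landed as
`norm_galAdicCompletionMap` (`AdelicVectorHeightGalois`). Model-construction cell node W8t.
-/

set_option autoImplicit false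

noncomputable section

open _root_.Topology _root_.Filter _root_.Set _root_.Function _root_.MeasureTheory
open scoped Pointwise NNReal
open NumberField IsDedekindDomain

namespace Literature.NumberTheory.Automorphic

/-! ## § 1. Galois invariance of the idele norm (the tree's `ideleNorm_unitsMap_galRingHom`, restated
for the `ℝ≥0`-valued norm `IdeleClassGroup.ideleNorm` and the action `σ • x` on `𝔸_Lˣ`) -/

section GaloisNorm

variable {K L : Type} [Field K] [Field L] [NumberField L] [Algebra K L]

/-- **Galois invariance of the idele norm**: `‖σ • x‖_L = ‖x‖_L` for `σ ∈ Aut(L/K)` (`σ` permutes the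
places, transporting the normalised absolute values; the tree's `ideleNorm_unitsMap_galRingHom`,
`IdeleNormGalConj`, transported along `coe_ideleNorm`). [cite: CasselsFrohlichANT1967, Ch. VII §1.1] -/
theorem ideleNorm_galSmul (σ : L ≃ₐ[K] L) (x : GaloisRepresentations.ideleGroup L) :
    IdeleClassGroup.ideleNorm L (σ • x) = IdeleClassGroup.ideleNorm L x := by
  have h : σ • x = Units.map (MulSemiringAction.toRingHom (L ≃ₐ[K] L) (AdeleRing (𝓞 L) L) σ :
      AdeleRing (𝓞 L) L →* AdeleRing (𝓞 L) L) x := Units.ext rfl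
  apply NNReal.coe_injective
  rw [coe_ideleNorm, coe_ideleNorm, h]
  exact ideleNorm_unitsMap_galRingHom K σ x

end GaloisNorm

/-! ## § 2. The torus `U(1)_{L/K}(𝔸_K) = ker N` and its rational points `L¹` -/

section Torus

variable (K L : Type) [Field K] [Field L] [NumberField L] [Algebra K L] [FiniteDimensional K L]

/-- **`U(1)_{L/K}(𝔸_K)`**: the ideles of `L` of relative norm one, `ker (N : 𝔸_Lˣ → 𝔸_Lˣ)`,
`N y = ∏_{σ ∈ Aut(L/K)} σ • y` (for `L/K` quadratic, `N y = y · ȳ`): the adelic points of the norm-one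
torus `ker (N_{L/K} : Res_{L/K} 𝔾_m → 𝔾_m)`, i.e. of the unitary group of a hermitian line over a CM
extension. [cite: PlatonovRapinchuk1994, §6.2] -/
def relNormOneIdeles : Subgroup (GaloisRepresentations.ideleGroup L) := (AdeleRing.ideleGalNorm K L).ker

/-- Membership in the torus: `N y = 1`. [folklore] -/
theorem mem_relNormOneIdeles_iff (y : GaloisRepresentations.ideleGroup L) :
    y ∈ relNormOneIdeles K L ↔ AdeleRing.ideleGalNorm K L y = 1 := Iff.rfl

/-- Membership in the torus: `∏_σ σ • y = 1`. [folklore] -/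
theorem mem_relNormOneIdeles_iff_prod (y : GaloisRepresentations.ideleGroup L) :
    y ∈ relNormOneIdeles K L ↔ ∏ σ : L ≃ₐ[K] L, σ • y = 1 := Iff.rfl

/-- `‖N y‖_L = ‖y‖_L ^ #Aut(L/K)`. [folklore] -/
theorem ideleNorm_ideleGalNorm (y : GaloisRepresentations.ideleGroup L) :
    IdeleClassGroup.ideleNorm L (AdeleRing.ideleGalNorm K L y) =
      IdeleClassGroup.ideleNorm L y ^ Fintype.card (L ≃ₐ[K] L) := by
  rw [AdeleRing.ideleGalNorm_apply, map_prod]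
  simp_rw [ideleNorm_galSmul]
  rw [Finset.prod_const, Finset.card_univ]

/-- **`U(1)_{L/K}(𝔸_K) ≤ 𝕀_L¹`**: a relative-norm-one idele has idele norm one (`‖y‖ ^ #Aut = ‖N y‖ = 1`).
[folklore] -/
theorem relNormOneIdeles_le_normOneIdeles : relNormOneIdeles K L ≤ normOneIdeles L := by
  intro y hy
  rw [mem_normOneIdeles]
  have h := ideleNorm_ideleGalNorm K L y
  rw [(mem_relNormOneIdeles_iff K L y).mp hy, map_one] at h
  have h' : ((IdeleClassGroup.ideleNorm L y : ℝ≥0) : ℝ) ^ Fintype.card (L ≃ₐ[K] L) = 1 := by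
    rw [← NNReal.coe_pow, ← h, NNReal.coe_one]
  exact NNReal.coe_injective
    ((pow_eq_one_iff_of_nonneg (IdeleClassGroup.ideleNorm L y).2 Fintype.card_ne_zero).mp h')

/-- **`U(1)_{L/K}(K)`**: the rational points, i.e. the principal ideles of relative norm one, as a
subgroup of `U(1)_{L/K}(𝔸_K)` — the group `L¹` (for `L/K` Galois, `principal_mem_relNormOneIdeles_iff`).
[folklore] -/
def relNormOneRat : Subgroup (relNormOneIdeles K L) :=
  (GaloisRepresentations.principalIdeles L).subgroupOf (relNormOneIdeles K L)

/-- Membership in the rational points. [folklore] -/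
theorem mem_relNormOneRat_iff (a : relNormOneIdeles K L) :
    a ∈ relNormOneRat K L ↔
      (a : GaloisRepresentations.ideleGroup L) ∈ GaloisRepresentations.principalIdeles L := Iff.rfl

/-- The Galois norm of the principal idele `(ℓ)` is the principal idele `(N_{L/K} ℓ)` (`L/K` Galois;
Mathlib `Algebra.norm_eq_prod_automorphisms`). [folklore] -/
theorem coe_ideleGalNorm_principal [IsGalois K L] (ℓ : Lˣ) :
    ((AdeleRing.ideleGalNorm K L
        (Units.map (algebraMap L (AdeleRing (𝓞 L) L) : L →* AdeleRing (𝓞 L) L) ℓ) :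
        GaloisRepresentations.ideleGroup L) : AdeleRing (𝓞 L) L) =
      algebraMap L (AdeleRing (𝓞 L) L) (algebraMap K L (Algebra.norm K (ℓ : L))) := by
  rw [AdeleRing.ideleGalNorm_apply, Units.coe_prod, Algebra.norm_eq_prod_automorphisms K, map_prod]
  refine Finset.prod_congr rfl fun σ _ => ?_
  rw [AdeleRing.coe_smul_units, Units.coe_map, MonoidHom.coe_coe, AdeleRing.smul_algebraMap]

/-- **`U(1)_{L/K}(K) = ker (N_{L/K} : Lˣ → Kˣ)`**: for `L/K` Galois the principal idele `(ℓ)` lies in the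
torus iff `N_{L/K}(ℓ) = 1`. [folklore] -/
theorem principal_mem_relNormOneIdeles_iff [IsGalois K L] (ℓ : Lˣ) :
    Units.map (algebraMap L (AdeleRing (𝓞 L) L) : L →* AdeleRing (𝓞 L) L) ℓ ∈ relNormOneIdeles K L ↔
      Algebra.norm K (ℓ : L) = 1 := by
  rw [mem_relNormOneIdeles_iff, ← Units.val_eq_one, coe_ideleGalNorm_principal,
    map_eq_one_iff _ (AdeleRing.algebraMap_injective (𝓞 L) L),
    map_eq_one_iff _ (algebraMap K L).injective]

/-! ### Topology, I: Hausdorff; the rational points are discrete and closed; norm-one representatives -/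

/-- `𝔸_Lˣ` is Hausdorff (the tree's `t2Space_ideleGroup`, registered as an instance on the way to the
torus). [folklore] -/
instance t2Space_relNormOneIdeles : T2Space (relNormOneIdeles K L) := by
  haveI := t2Space_ideleGroup L
  infer_instance

/-- **`U(1)(K) = L¹` is a discrete subgroup of `U(1)(𝔸_K)`**: it injects continuously into the discrete
`Lˣ ≤ 𝔸_Lˣ` (the tree's `discreteTopology_principalIdeles`, Cassels–Fröhlich, Ch. II §16 Lemma).
[cite: CasselsFrohlichANT1967, Ch. II §16 Lemma] -/
instance discreteTopology_relNormOneRat : DiscreteTopology (relNormOneRat K L) := by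
  haveI := discreteTopology_principalIdeles L
  exact DiscreteTopology.of_continuous_injective
    (f := fun a : relNormOneRat K L =>
      (⟨((a : relNormOneIdeles K L) : GaloisRepresentations.ideleGroup L), a.2⟩ :
        GaloisRepresentations.principalIdeles L))
    ((continuous_subtype_val.comp continuous_subtype_val).subtype_mk _)
    fun a b h => Subtype.ext (Subtype.ext (Subtype.mk.inj h))

/-- `L¹` is closed in `U(1)(𝔸_K)` (discrete subgroups of Hausdorff groups are closed). [folklore] -/
instance isClosed_relNormOneRat : IsClosed (relNormOneRat K L : Set (relNormOneIdeles K L)) :=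
  Subgroup.isClosed_of_discrete

/-- The automorphic quotient `[U(1)] = L¹ \ U(1)(𝔸_K)` is Hausdorff. [folklore] -/
instance t2Space_relNormOneQuot : T2Space (relNormOneIdeles K L ⧸ relNormOneRat K L) := inferInstance

/-- **The norm-one ideles admit a compact set of representatives modulo `Lˣ`** (Cassels' form of
"`J¹/kˣ` compact"): there is a compact
`W ⊆ 𝔸_Lˣ` such that every norm-one idele `a` satisfies `a k ∈ W` for some principal idele `k` — read
off the tree's `exists_finset_normBox_of_ideleNorm_eq_one` (`a = t̃ z (k)`, `t` in a finite set, `z` in a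
compact box). [cite: CasselsFrohlichANT1967, Ch. II §16 Theorem] -/
theorem exists_isCompact_cover_normOneIdeles :
    ∃ W : Set (GaloisRepresentations.ideleGroup L), IsCompact W ∧
      ∀ a ∈ normOneIdeles L, ∃ k ∈ GaloisRepresentations.principalIdeles L, a * k ∈ W := by
  classical
  obtain ⟨T, R, R', hT⟩ := exists_finset_normBox_of_ideleNorm_eq_one L
  refine ⟨⋃ t ∈ T, (fun z => finiteIdele L t * z) ''
      normBox L (LangWave0.ideleNorm L (finiteIdele L t))⁻¹ (R t) (R' t),
    T.isCompact_biUnion fun t _ => (isCompact_normBox L _ _ _).image (continuous_const_mul _),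
    fun a ha => ?_⟩
  obtain ⟨t, ht, k, z, hz, hxe⟩ := hT a ((langIdeleNorm_eq_one_iff a).mpr ha)
  refine ⟨(principalIdele L k)⁻¹, inv_mem (principalIdele_mem L k), ?_⟩
  simp only [Set.mem_iUnion, Set.mem_image, exists_prop]
  exact ⟨t, ht, z, hz, by rw [hxe, mul_inv_cancel_right]⟩

/-- Borel σ-algebra on `[U(1)_{L/K}]`. [folklore] -/
instance measurableSpace_relNormOneQuot : MeasurableSpace (relNormOneIdeles K L ⧸ relNormOneRat K L) :=
  borel _

/-- `[U(1)_{L/K}]` is a Borel space (by definition of the σ-algebra). [folklore] -/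
instance borelSpace_relNormOneQuot : BorelSpace (relNormOneIdeles K L ⧸ relNormOneRat K L) := ⟨rfl⟩

end Torus

/-! ### Topology, II (`K` a number field): closed in `𝔸_Lˣ`, locally compact, and `[U(1)]` compact -/

section TorusTopology

variable (K L : Type) [Field K] [Field L] [NumberField K] [NumberField L] [Algebra K L]

/-- `U(1)_{L/K}(𝔸_K)` is closed in `𝔸_Lˣ` (`N` is continuous: the tree's `continuous_ideleGalNorm`,
`NormGroupClosedProofs`). [folklore] -/
theorem isClosed_relNormOneIdeles :
    IsClosed (relNormOneIdeles K L : Set (GaloisRepresentations.ideleGroup L)) := by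
  haveI := t2Space_ideleGroup L
  rw [relNormOneIdeles, MonoidHom.coe_ker]
  exact isClosed_singleton.preimage (continuous_ideleGalNorm K L)

/-- `U(1)_{L/K}(𝔸_K)` is locally compact: a closed subgroup of the locally compact `𝔸_Lˣ`
(`locallyCompactSpace_adeleRing'`; units of a locally compact Hausdorff ring). [folklore] -/
instance locallyCompactSpace_relNormOneIdeles : LocallyCompactSpace (relNormOneIdeles K L) := by
  haveI := locallyCompactSpace_adeleRing' L
  haveI := t2Space_ideleGroup L
  haveI : T2Space (AdeleRing (𝓞 L) L) := by
    haveI : T2Space (InfiniteAdeleRing L) :=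
      inferInstanceAs (T2Space ((v : InfinitePlace L) → v.Completion))
    haveI : T2Space (FiniteAdeleRing (𝓞 L) L) :=
      inferInstanceAs (T2Space (RestrictedProduct
        (fun v : HeightOneSpectrum (𝓞 L) => v.adicCompletion L)
        (fun v => (v.adicCompletionIntegers L : Set (v.adicCompletion L))) Filter.cofinite))
    exact inferInstanceAs (T2Space (InfiniteAdeleRing L × FiniteAdeleRing (𝓞 L) L))
  haveI : LocallyCompactSpace (GaloisRepresentations.ideleGroup L) := inferInstance
  exact (isClosed_relNormOneIdeles K L).isClosedEmbedding_subtypeVal.locallyCompactSpace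

/-! ### Compactness of `[U(1)_{L/K}]` -/

/-- **`[U(1)_{L/K}] = L¹ \ U(1)(𝔸_K)` is compact** — Godement's criterion for the anisotropic torus
`U(1)_{L/K}` (Sém. Bourbaki 257, §5 Thm. 4; Platonov–Rapinchuk Thm. 5.5), proved here from the
compactness of `𝕀_L¹/Lˣ` by finite representatives (module docstring). [cite: Godement1964, §5 Thm. 4] -/
instance compactSpace_relNormOneQuot : CompactSpace (relNormOneIdeles K L ⧸ relNormOneRat K L) := by
  classical
  set N := AdeleRing.ideleGalNorm K L with hN
  have hNc : Continuous N := continuous_ideleGalNorm K L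
  obtain ⟨W, hWc, hW⟩ := exists_isCompact_cover_normOneIdeles L
  -- the finite set `F = N(W) ∩ Lˣ`
  set F : Set (GaloisRepresentations.ideleGroup L) :=
    N '' W ∩ (GaloisRepresentations.principalIdeles L : Set (GaloisRepresentations.ideleGroup L)) with hF
  haveI := discreteTopology_principalIdeles L
  haveI := t2Space_ideleGroup L
  have hPd : IsDiscrete
      (GaloisRepresentations.principalIdeles L : Set (GaloisRepresentations.ideleGroup L)) :=
    SetLike.isDiscrete_iff_discreteTopology.mpr inferInstance
  have hFfin : F.Finite :=
    ((hWc.image hNc).inter_right (isClosed_principalIdeles L)).finite (hPd.mono inter_subset_right)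
  -- representatives `k_m ∈ Lˣ` with `N k_m = m` whenever `m` is a norm from `Lˣ`
  let rep : GaloisRepresentations.ideleGroup L → GaloisRepresentations.ideleGroup L := fun m =>
    if h : ∃ k ∈ GaloisRepresentations.principalIdeles L, N k = m then h.choose else 1
  have hrep_mem : ∀ m, rep m ∈ GaloisRepresentations.principalIdeles L := by
    intro m
    by_cases h : ∃ k ∈ GaloisRepresentations.principalIdeles L, N k = m
    · simp only [rep, dif_pos h]; exact h.choose_spec.1
    · simp only [rep, dif_neg h]; exact one_mem _
  have hrep_N : ∀ m, (∃ k ∈ GaloisRepresentations.principalIdeles L, N k = m) → N (rep m) = m := by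
    intro m h
    simp only [rep, dif_pos h]
    exact h.choose_spec.2
  -- the compact set `C = ⋃_{m ∈ F} W · k_m⁻¹`, its trace on the closed torus, and the image
  set C : Set (GaloisRepresentations.ideleGroup L) := ⋃ m ∈ F, (fun w => w * (rep m)⁻¹) '' W with hC
  have hCc : IsCompact C := hFfin.isCompact_biUnion fun m _ => hWc.image (continuous_mul_const _)
  have hCA : IsCompact ((Subtype.val : relNormOneIdeles K L → GaloisRepresentations.ideleGroup L) ⁻¹' C) :=
    (isClosed_relNormOneIdeles K L).isClosedEmbedding_subtypeVal.isCompact_preimage hCc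
  have himg : (QuotientGroup.mk : relNormOneIdeles K L → relNormOneIdeles K L ⧸ relNormOneRat K L) ''
      ((Subtype.val : relNormOneIdeles K L → GaloisRepresentations.ideleGroup L) ⁻¹' C) = Set.univ := by
    refine Set.eq_univ_of_forall fun q => ?_
    induction q using QuotientGroup.induction_on with
    | H a =>
      have ha : (a : GaloisRepresentations.ideleGroup L) ∈ relNormOneIdeles K L := a.2
      have hNa : N a = 1 := (mem_relNormOneIdeles_iff K L a).mp ha
      -- `a ∈ 𝕀¹`, so `a k ∈ W` for some principal `k`; `m := N k = N (a k) ∈ N(W) ∩ Lˣ`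
      obtain ⟨k, hk, hakW⟩ := hW a (relNormOneIdeles_le_normOneIdeles K L ha)
      have hmF : N k ∈ F := by
        refine ⟨⟨(a : GaloisRepresentations.ideleGroup L) * k, hakW, ?_⟩,
          ideleGalNorm_mem_principalIdeles K L hk⟩
        rw [map_mul, hNa, one_mul]
      have hNrep : N (rep (N k)) = N k := hrep_N (N k) ⟨k, hk, rfl⟩
      -- `c := a k k_m⁻¹ ∈ C ∩ ker N`, and `c ≡ a (mod L¹)`
      have hcA : (a : GaloisRepresentations.ideleGroup L) * k * (rep (N k))⁻¹ ∈ relNormOneIdeles K L := by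
        rw [mem_relNormOneIdeles_iff, map_mul, map_mul, map_inv, hNa, one_mul, hNrep, mul_inv_cancel]
      have hcC : (a : GaloisRepresentations.ideleGroup L) * k * (rep (N k))⁻¹ ∈ C :=
        Set.mem_biUnion hmF ⟨(a : GaloisRepresentations.ideleGroup L) * k, hakW, rfl⟩
      refine ⟨⟨_, hcA⟩, hcC, QuotientGroup.eq.mpr ?_⟩
      rw [mem_relNormOneRat_iff]
      change ((a : GaloisRepresentations.ideleGroup L) * k * (rep (N k))⁻¹)⁻¹ *
          (a : GaloisRepresentations.ideleGroup L) ∈ GaloisRepresentations.principalIdeles L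
      rw [show ((a : GaloisRepresentations.ideleGroup L) * k * (rep (N k))⁻¹)⁻¹ *
            (a : GaloisRepresentations.ideleGroup L) = rep (N k) * k⁻¹ by
        rw [mul_inv_rev, mul_inv_rev, inv_inv, mul_assoc, mul_assoc, inv_mul_cancel, mul_one]]
      exact mul_mem (hrep_mem _) (inv_mem hk)
  exact ⟨by rw [← himg]; exact hCA.image continuous_quot_mk⟩

/-! ### The Haar probability measure `du` on `[U(1)]` -/

/-- The measure `du` on `[U(1)_{L/K}]`: Haar measure of the compact abelian group. [folklore] -/
def haarRelNormOneQuot : Measure (relNormOneIdeles K L ⧸ relNormOneRat K L) := Measure.haar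

/-- `du` is a finite measure (compact group). [folklore] -/
instance isFiniteMeasure_haarRelNormOneQuot : IsFiniteMeasure (haarRelNormOneQuot K L) := by
  unfold haarRelNormOneQuot; infer_instance

/-- `du` is positive on non-empty open sets. [folklore] -/
instance isOpenPosMeasure_haarRelNormOneQuot : (haarRelNormOneQuot K L).IsOpenPosMeasure := by
  unfold haarRelNormOneQuot; infer_instance

/-- `du` is left invariant. [folklore] -/
instance isMulLeftInvariant_haarRelNormOneQuot : (haarRelNormOneQuot K L).IsMulLeftInvariant := by
  unfold haarRelNormOneQuot; infer_instance

/-- `du` is right invariant (the group is abelian). [folklore] -/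
theorem map_mul_right_haarRelNormOneQuot (g : relNormOneIdeles K L ⧸ relNormOneRat K L) :
    Measure.map (· * g) (haarRelNormOneQuot K L) = haarRelNormOneQuot K L := by
  have h : (fun x : relNormOneIdeles K L ⧸ relNormOneRat K L => x * g) = fun x => g * x :=
    funext fun x => mul_comm x g
  rw [h]
  exact map_mul_left_eq_self _ g

/-- `du` is right invariant. [folklore] -/
instance isMulRightInvariant_haarRelNormOneQuot : (haarRelNormOneQuot K L).IsMulRightInvariant :=
  ⟨map_mul_right_haarRelNormOneQuot K L⟩

end TorusTopology

/-! ## § 3. The CM case `K = L⁺`: `U(W) = U(1)_{L/L⁺}`, `N y = y · ȳ` -/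

section CM

variable (L : Type) [Field L] [NumberField L] [IsCMField L]

open scoped Classical in
/-- `Aut(L/L⁺) = {1, c}`, `c` = complex conjugation (`L/L⁺` is quadratic, Mathlib
`IsCMField.isQuadraticExtension`, and `c ≠ 1`, `IsCMField.complexConj_ne_one`). [folklore] -/
theorem univ_algEquiv_maximalRealSubfield_eq_pair :
    (Finset.univ : Finset (L ≃ₐ[maximalRealSubfield L] L)) = {1, IsCMField.complexConj L} := by
  symm
  apply Finset.eq_univ_of_card
  rw [Finset.card_pair (IsCMField.complexConj_ne_one L).symm, ← Nat.card_eq_fintype_card,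
    IsGalois.card_aut_eq_finrank,
    Algebra.IsQuadraticExtension.finrank_eq_two (maximalRealSubfield L) L]

/-- For a CM field the Galois norm of an idele over `L⁺` is `N y = y · ȳ`. [folklore] -/
theorem ideleGalNorm_eq_mul_complexConj_smul (y : GaloisRepresentations.ideleGroup L) :
    AdeleRing.ideleGalNorm (maximalRealSubfield L) L y = y * IsCMField.complexConj L • y := by
  classical
  rw [AdeleRing.ideleGalNorm_apply, univ_algEquiv_maximalRealSubfield_eq_pair,
    Finset.prod_pair (IsCMField.complexConj_ne_one L).symm, one_smul]

/-- **`U(1)(𝔸_{L⁺}) = {y ∈ 𝔸_Lˣ : y ȳ = 1}`**: membership in the torus of a CM field is the unitarity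
relation of a hermitian line over `L/L⁺`. [folklore] -/
theorem mem_relNormOneIdeles_iff_mul_conj (y : GaloisRepresentations.ideleGroup L) :
    y ∈ relNormOneIdeles (maximalRealSubfield L) L ↔ y * IsCMField.complexConj L • y = 1 := by
  rw [mem_relNormOneIdeles_iff, ideleGalNorm_eq_mul_complexConj_smul]

end CM

end Literature.NumberTheory.Automorphic

end
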